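import Summits.Ventures.QEC.Census.CertCoverBatch
import Summits.Ventures.QEC.Census.TwoBGA.TB_l6m24_A0_0_0_1_3_11_B0_0_1_11_5_4.Q144.CoreDefs
import HarnessLib

set_option Elab.async false
set_option maxRecDepth 200000

/-!
# `quotient-[[144,12,d_Z≥8]]` one-level cover certificate of `TB_l6m24_A0_0_0_1_3_11_B0_0_1_11_5_4.Q144` — LEVEL-1→0 coset problems 0…0 (deep problems [] excluded: `ProbDeep*.lean`) as COMPACT data
(`ProbData`: U, f, σ, y₀, allow; qec-type-10 `CertCoverBatch.mkCoset` rebuilds each `CosetProb` in the kernel) + their verdict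
`probsOK cov covR hx hx1 D1 lxd 6` (one `decide +kernel`; 1 problems, depths f=0:1 f=1:0 f=2:0 f=3:0, est. 3.5 s).
qec-search-1 g5 (pattern of search-9 g5 `Probs*`); data from JSON `level10.problems` (sha256 e921f0c5e1e2190a…). Data + decided check; KERNEL.
-/

namespace Summit.Ventures.QEC.Census.TB_l6m24_A0_0_0_1_3_11_B0_0_1_11_5_4.Q144

open Matrix Summit.Ventures.QEC.Census Literature.InformationTheory.QuantumCodes

/-- Problems 0…0 (1): `⟨U, f, σ, y₀, allow⟩`. -/
def probs00 : List ProbData := [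
    ⟨18017698118107296, 0, 35500851200, 3298534883488, [0]⟩]

set_option maxHeartbeats 400000000 in
/-- Every problem of this chunk passes (`mkCoset` elimination + `cosetOKD` + fast `σ` + depth + `BU`-evenness + label checks). -/
theorem probs00_ok : probsOK TB_l6m24_A0_0_0_1_3_11_B0_0_1_11_5_4.Q144.cov covR hx hx1 D1 lxd 6 probs00 = true := by
  decide +kernel

/-- Pointwise form. -/
theorem probs00_all : ∀ x ∈ TB_l6m24_A0_0_0_1_3_11_B0_0_1_11_5_4.Q144.probs00, probOK cov covR hx hx1 D1 lxd 6 x = true := by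
  have h := probs00_ok
  rwa [probsOK, List.all_eq_true] at h

end Summit.Ventures.QEC.Census.TB_l6m24_A0_0_0_1_3_11_B0_0_1_11_5_4.Q144
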